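import Literature.Analysis.FluidPDE.AncientSimilarityVorticity
import Literature.Analysis.FluidPDE.WholeSpaceIBP
import HarnessLib

/-!
# The cut-off Gaussian energy inequality for the induction equation in Leray's wind
# (route `CorkscrewDynamo`, item `NoSmallConstantWindDynamo`, stmt-NavierStokesRegularity-11288)

Helper file (all results proved) for the small-constant kinematic anti-dynamo theorem in the wind
(`NoSmallConstantWindDynamo`): for a steady divergence-free wind `B` with `|y| |B(y)| ≤ a`,
`‖DB(y)‖ ≤ b`, a divergence-free `C²` field `Ω`, the Gaussian weight `γ(y) = e^{−|y|²/4}` and a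
`C¹` cut-off `χ` with `|χ| ≤ 1` and compact support, the SLICE INEQUALITY
`∫ γ χ² ⟪Ω, curl((B + ½y) × Ω) + ΔΩ⟫ ≤ −(1 − b − a/4) ∫ γ χ² |Ω|² + ∫ γ (‖Dχ‖ |B| + 3‖Dχ‖²) |Ω|²`
(`integral_gaussian_cutoff_inner_induction_le`). Only first derivatives of the cut-off enter:
the cross term `−2 Σᵢ ∫ γ χ ∂ᵢχ ⟪∂ᵢΩ, Ω⟫` produced by the Gaussian Green identity of the tree
(`integral_gaussian_inner_laplacian_sub_half_fderiv`, which also absorbs Leray's transport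
`−½ (y·∇)Ω` exactly: `Δ − ½ y·∇` is symmetric on `L²(γ)`) is absorbed by Young's inequality into
the dissipation `−∫ γ χ² |∇Ω|²`; the drift `(B·∇)Ω` is integrated by parts
(`integral_gaussian_inner_convect_self`), producing `¼ ∫ γχ² (y·B) |Ω|² ≤ (a/4) ∫ γχ²|Ω|²` and a
cut-off error `∫ γ χ Dχ[B] |Ω|²`; the stretching `⟪Ω, DB Ω⟫ ≤ b |Ω|²` and the dilution `−|Ω|²`
(`curl(½y × Ω) = −Ω − ½(y·∇)Ω`, `curl_cross_add_half_id_apply`) give the rate.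

References: the `L²(γ)` energy identity is the standard Backus/Childress-type anti-dynamo bound
(Davidson 2001, §5; Backus 1958) transplanted to the whole space with Leray's drift; folklore.
-/

noncomputable section

open MeasureTheory Set Function Filter Topology
open scoped Laplacian InnerProductSpace RealInnerProductSpace ContDiff

namespace Summit.NavierStokesRegularity.NavierStokesRegularity.Theorems

-- the summit and its single sub-problem share the name (CONVENTIONS §1), as in every Theorems file
set_option linter.dupNamespace false

open Literature.Analysis Literature.Analysis.FluidPDE

/-- **The induction term paired with the field.** At a point where the divergence-free fields
`B`, `Ω` are differentiable,
`⟪Ω, curl((B + ½y) × Ω)⟫ = ⟪Ω, DB Ω⟫ − ⟪(B·∇)Ω, Ω⟫ − |Ω|² − ½ ⟪DΩ y, Ω⟫`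
(stretching, drift, dilution, Leray transport; from the tree's `curl_cross_add_half_id_apply`).
[folklore] -/
theorem inner_curl_cross_wind_eq {B Ω : EuclideanSpace ℝ (Fin 3) → EuclideanSpace ℝ (Fin 3)} {y : EuclideanSpace ℝ (Fin 3)} (hB : DifferentiableAt ℝ B y)
    (hΩ : DifferentiableAt ℝ Ω y) (hdivB : VectorCalculus.divergence B y = 0)
    (hdivΩ : VectorCalculus.divergence Ω y = 0) :
    ⟪Ω y, curl (fun z => cross (B z + (1 / 2 : ℝ) • z) (Ω z)) y⟫ =
      ⟪Ω y, fderiv ℝ B y (Ω y)⟫ - ⟪convect B Ω y, Ω y⟫ - ‖Ω y‖ ^ 2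
        - (1 / 2 : ℝ) * ⟪fderiv ℝ Ω y y, Ω y⟫ := by
  rw [curl_cross_add_half_id_apply hB hΩ, hdivB, hdivΩ, zero_smul, zero_smul, sub_zero, add_zero,
    convect_apply, inner_sub_right, inner_sub_right, inner_sub_right, inner_smul_right,
    real_inner_self_eq_norm_sq, real_inner_comm (Ω y) (fderiv ℝ Ω y (B y)),
    real_inner_comm (Ω y) (fderiv ℝ Ω y y)]

/-- **The drift term against the cut-off Gaussian weight.** For `B ∈ C¹` divergence free,
`Ω ∈ C¹` and a compactly supported `C¹` cut-off `χ`, with `γ = e^{−|y|²/4}`,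
`∫ γ χ² ⟪(B·∇)Ω, Ω⟫ = ¼ ∫ γ χ² ⟪y, B⟫ |Ω|² − ∫ γ χ Dχ[B] |Ω|²`
(the tree's `integral_gaussian_inner_convect_self` for the field `χ Ω`, and the Leibniz rule
`(B·∇)(χΩ) = χ (B·∇)Ω + Dχ[B] Ω`). [folklore] -/
theorem integral_gaussian_cutoff_sq_inner_convect {B Ω : EuclideanSpace ℝ (Fin 3) → EuclideanSpace ℝ (Fin 3)} {χ : EuclideanSpace ℝ (Fin 3) → ℝ}
    (hB : ContDiff ℝ 1 B) (hdivB : VectorCalculus.IsDivFree B) (hΩ : ContDiff ℝ 1 Ω)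
    (hχ : ContDiff ℝ 1 χ) (hχc : HasCompactSupport χ) :
    ∫ y, Real.exp (-‖y‖ ^ 2 / 4) * χ y ^ 2 * ⟪convect B Ω y, Ω y⟫ =
      (1 / 4 : ℝ) * (∫ y, Real.exp (-‖y‖ ^ 2 / 4) * χ y ^ 2 * (⟪y, B y⟫ * ‖Ω y‖ ^ 2))
        - ∫ y, Real.exp (-‖y‖ ^ 2 / 4) * (χ y * fderiv ℝ χ y (B y) * ‖Ω y‖ ^ 2) := by
  set γ : EuclideanSpace ℝ (Fin 3) → ℝ := fun y => Real.exp (-‖y‖ ^ 2 / 4) with hγdef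
  -- the cut-off field `χ Ω`
  set w : EuclideanSpace ℝ (Fin 3) → EuclideanSpace ℝ (Fin 3) := fun y => χ y • Ω y with hwdef
  have hw : ContDiff ℝ 1 w := hχ.smul hΩ
  have hcw : HasCompactSupport w :=
    HasCompactSupport.intro hχc fun y hy => by simp [hwdef, image_eq_zero_of_notMem_tsupport hy]
  have key := integral_gaussian_inner_convect_self hB hw hcw
  -- pointwise identities
  have hconv : ∀ y, convect B w y = χ y • convect B Ω y + (fderiv ℝ χ y (B y)) • Ω y := fun y =>
    convect_smul_apply (hχ.differentiable one_ne_zero y) (hΩ.differentiable one_ne_zero y)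
  have e1 : (fun y => γ y * ⟪convect B w y, w y⟫) = fun y =>
      γ y * χ y ^ 2 * ⟪convect B Ω y, Ω y⟫ + γ y * (χ y * fderiv ℝ χ y (B y) * ‖Ω y‖ ^ 2) := by
    funext y
    rw [hconv y, hwdef]
    simp only [inner_add_left, real_inner_smul_left, real_inner_smul_right, real_inner_self_eq_norm_sq]
    ring
  have e2 : (fun y => γ y * (⟪y, B y⟫ * ‖w y‖ ^ 2)) = fun y => γ y * χ y ^ 2 * (⟪y, B y⟫ * ‖Ω y‖ ^ 2) := by
    funext y
    rw [hwdef]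
    simp only [norm_smul, Real.norm_eq_abs, mul_pow, sq_abs]
    ring
  have e3 : (fun y => γ y * (VectorCalculus.divergence B y * ‖w y‖ ^ 2)) = fun _ => 0 := by
    funext y
    rw [hdivB y]
    ring
  rw [e1, e2, e3, integral_zero, mul_zero, sub_zero] at key
  -- integrability (continuous, compactly supported integrands)
  have cγ : Continuous γ := (contDiff_gaussianWeightFun (n := 0)).continuous
  have cχ : Continuous χ := hχ.continuous
  have cDχ : Continuous (fderiv ℝ χ) := hχ.continuous_fderiv one_ne_zero
  have cB : Continuous B := hB.continuous
  have cΩ : Continuous Ω := hΩ.continuous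
  have cDΩ : Continuous (fderiv ℝ Ω) := hΩ.continuous_fderiv one_ne_zero
  have hK : ∀ y ∉ tsupport χ, χ y = 0 := fun y hy => image_eq_zero_of_notMem_tsupport hy
  have hK' : ∀ y ∉ tsupport χ, fderiv ℝ χ y = 0 := fun y hy => fderiv_of_notMem_tsupport ℝ hy
  have hiA : Integrable (fun y => γ y * χ y ^ 2 * ⟪convect B Ω y, Ω y⟫) := by
    refine Continuous.integrable_of_hasCompactSupport
      ((cγ.mul (cχ.pow 2)).mul ((cDΩ.clm_apply cB).inner cΩ)) (HasCompactSupport.intro hχc fun y hy => ?_)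
    simp [hK y hy]
  have hiB : Integrable (fun y => γ y * (χ y * fderiv ℝ χ y (B y) * ‖Ω y‖ ^ 2)) := by
    refine Continuous.integrable_of_hasCompactSupport
      (cγ.mul ((cχ.mul (cDχ.clm_apply cB)).mul (cΩ.norm.pow 2))) (HasCompactSupport.intro hχc fun y hy => ?_)
    simp [hK y hy]
  rw [integral_add hiA hiB] at key
  simp only [hγdef] at key ⊢
  linarith

/-- **Dissipation, Leray transport and the cut-off gradient.** For `Ω ∈ C²`, a compactly supported
`C¹` cut-off `χ` and `γ = e^{−|y|²/4}`:
`∫ γ ⟪ΔΩ − ½ DΩ[y], χ² Ω⟫ ≤ 3 ∫ γ ‖Dχ‖² |Ω|²`.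
By the Gaussian Green identity of the tree (`integral_gaussian_inner_laplacian_sub_half_fderiv`:
`Δ − ½y·∇` is symmetric on `L²(γ)`) the left side is `−Σᵢ ∫ γ ⟪∂ᵢΩ, χ² ∂ᵢΩ + 2χ ∂ᵢχ Ω⟫`, and
pointwise `−χ²|∂ᵢΩ|² − 2χ ∂ᵢχ ⟪∂ᵢΩ, Ω⟫ ≤ (∂ᵢχ)² |Ω|² ≤ ‖Dχ‖² |Ω|²` (Young): the dissipation
absorbs the cross term, and only FIRST derivatives of the cut-off remain. [folklore] -/
theorem integral_gaussian_inner_laplacian_leray_cutoff_sq_le {Ω : EuclideanSpace ℝ (Fin 3) → EuclideanSpace ℝ (Fin 3)} {χ : EuclideanSpace ℝ (Fin 3) → ℝ}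
    (hΩ : ContDiff ℝ 2 Ω) (hχ : ContDiff ℝ 1 χ) (hχc : HasCompactSupport χ) :
    ∫ y, Real.exp (-‖y‖ ^ 2 / 4) * ⟪(Δ Ω) y - (1 / 2 : ℝ) • fderiv ℝ Ω y y, χ y ^ 2 • Ω y⟫ ≤
      3 * ∫ y, Real.exp (-‖y‖ ^ 2 / 4) * (‖fderiv ℝ χ y‖ ^ 2 * ‖Ω y‖ ^ 2) := by
  set γ : EuclideanSpace ℝ (Fin 3) → ℝ := fun y => Real.exp (-‖y‖ ^ 2 / 4) with hγdef
  set b := EuclideanSpace.basisFun (Fin 3) ℝ with hbdef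
  set g : EuclideanSpace ℝ (Fin 3) → EuclideanSpace ℝ (Fin 3) := fun y => χ y ^ 2 • Ω y with hgdef
  have hΩ1 : ContDiff ℝ 1 Ω := hΩ.of_le one_le_two
  have hχ2 : ContDiff ℝ 1 fun y => χ y ^ 2 := hχ.pow 2
  have hg : ContDiff ℝ 1 g := hχ2.smul hΩ1
  have hcg : HasCompactSupport g := HasCompactSupport.intro hχc fun y hy => by
    simp [hgdef, image_eq_zero_of_notMem_tsupport hy]
  have key := integral_gaussian_inner_laplacian_sub_half_fderiv b hΩ hg (Or.inr hcg)
  rw [key]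
  -- the derivative of the cut-off field `g = χ² Ω`
  have hDχ2 : ∀ y v, fderiv ℝ (fun y => χ y ^ 2) y v = 2 * χ y * fderiv ℝ χ y v := by
    intro y v
    rw [((hχ.differentiable one_ne_zero y).hasFDerivAt.pow 2).fderiv]
    simp [smul_eq_mul]
  have hDg : ∀ y i, fderiv ℝ g y (b i) =
      χ y ^ 2 • fderiv ℝ Ω y (b i) + (2 * χ y * fderiv ℝ χ y (b i)) • Ω y := by
    intro y i
    rw [hgdef, fderiv_fun_smul (hχ2.differentiable one_ne_zero y) (hΩ1.differentiable one_ne_zero y)]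
    simp only [add_apply, smul_apply, ContinuousLinearMap.smulRight_apply, hDχ2]
  -- off the support of `χ` the cut-off field is flat
  have hK : ∀ y ∉ tsupport χ, χ y = 0 := fun y hy => image_eq_zero_of_notMem_tsupport hy
  have hK' : ∀ y ∉ tsupport χ, fderiv ℝ χ y = 0 := fun y hy => fderiv_of_notMem_tsupport ℝ hy
  -- continuity
  have cγ : Continuous γ := (contDiff_gaussianWeightFun (n := 0)).continuous
  have cχ : Continuous χ := hχ.continuous
  have cDχ : Continuous (fderiv ℝ χ) := hχ.continuous_fderiv one_ne_zero
  have cΩ : Continuous Ω := hΩ1.continuous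
  have cDΩ : Continuous (fderiv ℝ Ω) := hΩ1.continuous_fderiv one_ne_zero
  -- the majorant `γ ‖Dχ‖² |Ω|²`
  have hiM : Integrable (fun y => γ y * (‖fderiv ℝ χ y‖ ^ 2 * ‖Ω y‖ ^ 2)) := by
    refine Continuous.integrable_of_hasCompactSupport (cγ.mul ((cDχ.norm.pow 2).mul (cΩ.norm.pow 2)))
      (HasCompactSupport.intro hχc fun y hy => ?_)
    simp [hK' y hy]
  have cDg : Continuous (fderiv ℝ g) := hg.continuous_fderiv one_ne_zero
  -- each coordinate direction: Young's inequality absorbs the cross term into the dissipation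
  have hterm : ∀ i, -(∫ y, γ y * ⟪fderiv ℝ Ω y (b i), fderiv ℝ g y (b i)⟫) ≤
      ∫ y, γ y * (‖fderiv ℝ χ y‖ ^ 2 * ‖Ω y‖ ^ 2) := by
    intro i
    rw [← integral_neg]
    have hif : Integrable (fun y => γ y * ⟪fderiv ℝ Ω y (b i), fderiv ℝ g y (b i)⟫) := by
      refine Continuous.integrable_of_hasCompactSupport
        (cγ.mul ((cDΩ.clm_apply continuous_const).inner (cDg.clm_apply continuous_const)))
        (HasCompactSupport.intro hχc fun y hy => ?_)
      simp [hDg, hK y hy, hK' y hy]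
    refine integral_mono hif.neg hiM fun y => ?_
    have hγ0 : 0 ≤ γ y := (Real.exp_pos _).le
    have hbi : ‖b i‖ = 1 := b.orthonormal.1 i
    set P := fderiv ℝ Ω y (b i) with hP
    set d := fderiv ℝ χ y (b i) with hd
    set t := ⟪P, Ω y⟫ with htdef
    have ht : |t| ≤ ‖P‖ * ‖Ω y‖ := abs_real_inner_le_norm _ _
    have hdle : |d| ≤ ‖fderiv ℝ χ y‖ := by
      have := (fderiv ℝ χ y).le_opNorm (b i)
      rwa [hbi, mul_one, Real.norm_eq_abs] at this
    have hd2 : d ^ 2 ≤ ‖fderiv ℝ χ y‖ ^ 2 := by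
      rw [← sq_abs d]
      exact pow_le_pow_left₀ (abs_nonneg d) hdle 2
    have hyoung : -(χ y ^ 2 * ‖P‖ ^ 2 + 2 * χ y * d * t) ≤ d ^ 2 * ‖Ω y‖ ^ 2 := by
      have h1 : |2 * χ y * d * t| ≤ 2 * (|χ y| * ‖P‖) * (|d| * ‖Ω y‖) := by
        rw [abs_mul, abs_mul, abs_mul, abs_two]
        calc 2 * |χ y| * |d| * |t| ≤ 2 * |χ y| * |d| * (‖P‖ * ‖Ω y‖) :=
              mul_le_mul_of_nonneg_left ht (by positivity)
          _ = 2 * (|χ y| * ‖P‖) * (|d| * ‖Ω y‖) := by ring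
      have h2 : 2 * (|χ y| * ‖P‖) * (|d| * ‖Ω y‖) ≤ (|χ y| * ‖P‖) ^ 2 + (|d| * ‖Ω y‖) ^ 2 :=
        two_mul_le_add_sq _ _
      have h3 : -(2 * χ y * d * t) ≤ |2 * χ y * d * t| := neg_le_abs _
      rw [mul_pow, mul_pow, sq_abs, sq_abs] at h2
      linarith
    have hexp : ⟪P, fderiv ℝ g y (b i)⟫ = χ y ^ 2 * ‖P‖ ^ 2 + 2 * χ y * d * t := by
      rw [hDg y i, inner_add_right, real_inner_smul_right, real_inner_smul_right,
        real_inner_self_eq_norm_sq]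
    show -(γ y * ⟪P, fderiv ℝ g y (b i)⟫) ≤ γ y * (‖fderiv ℝ χ y‖ ^ 2 * ‖Ω y‖ ^ 2)
    rw [hexp, ← mul_neg]
    refine mul_le_mul_of_nonneg_left (hyoung.trans ?_) hγ0
    exact mul_le_mul_of_nonneg_right hd2 (sq_nonneg _)
  calc -∑ i, ∫ y, γ y * ⟪fderiv ℝ Ω y (b i), fderiv ℝ g y (b i)⟫
      = ∑ i, -(∫ y, γ y * ⟪fderiv ℝ Ω y (b i), fderiv ℝ g y (b i)⟫) := by
        rw [Finset.sum_neg_distrib]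
    _ ≤ ∑ _i : Fin 3, ∫ y, γ y * (‖fderiv ℝ χ y‖ ^ 2 * ‖Ω y‖ ^ 2) :=
        Finset.sum_le_sum fun i _ => hterm i
    _ = 3 * ∫ y, γ y * (‖fderiv ℝ χ y‖ ^ 2 * ‖Ω y‖ ^ 2) := by
        simp only [Finset.sum_const, Finset.card_univ, Fintype.card_fin, nsmul_eq_mul, Nat.cast_ofNat]

/-- **The slice inequality (cut-off Gaussian energy balance of the induction equation in Leray's
wind).** Let `B ∈ C¹(EuclideanSpace ℝ (Fin 3); EuclideanSpace ℝ (Fin 3))` be divergence free with `|y| |B(y)| ≤ a` and `‖DB(y)‖ ≤ b`, let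
`Ω ∈ C²(EuclideanSpace ℝ (Fin 3); EuclideanSpace ℝ (Fin 3))` be divergence free, `χ ∈ C¹` a compactly supported cut-off with `|χ| ≤ 1`, and
`γ(y) = e^{−|y|²/4}`. Then
`∫ γ χ² ⟪Ω, curl((B + ½y) × Ω) + ΔΩ⟫ ≤ −(1 − b − a/4) ∫ γ χ² |Ω|² + ∫ γ (‖Dχ‖ |B| + 3 ‖Dχ‖²) |Ω|²`:
stretching `⟪Ω, DB Ω⟫ ≤ b|Ω|²`, dilution `−|Ω|²`, drift `¼ γχ² (y·B)|Ω|² ≤ (a/4) γχ²|Ω|²` after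
integration by parts (`integral_gaussian_cutoff_sq_inner_convect`), and the symmetric part
`Δ − ½ y·∇` contributing only the cut-off error (`integral_gaussian_inner_laplacian_leray_cutoff_sq_le`).
For `χ → 1` this is the `L²(γ)` energy inequality `½ d/ds ‖Ω‖²_γ ≤ −(1 − b − a/4) ‖Ω‖²_γ` of the
small-constant anti-dynamo theorem (Backus 1958 / Davidson 2001 §5 type bound, in Leray's wind).
[folklore] -/
theorem integral_gaussian_cutoff_sq_inner_induction_le {a b : ℝ} {B Ω : EuclideanSpace ℝ (Fin 3) → EuclideanSpace ℝ (Fin 3)} {χ : EuclideanSpace ℝ (Fin 3) → ℝ}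
    (hB : ContDiff ℝ 1 B) (hdivB : VectorCalculus.IsDivFree B) (ha : ∀ y, ‖y‖ * ‖B y‖ ≤ a)
    (hb : ∀ y, ‖fderiv ℝ B y‖ ≤ b) (hΩ : ContDiff ℝ 2 Ω) (hdivΩ : VectorCalculus.IsDivFree Ω)
    (hχ : ContDiff ℝ 1 χ) (hχc : HasCompactSupport χ) (hχ1 : ∀ y, |χ y| ≤ 1) :
    ∫ y, Real.exp (-‖y‖ ^ 2 / 4) * χ y ^ 2 *
        ⟪Ω y, curl (fun z => cross (B z + (1 / 2 : ℝ) • z) (Ω z)) y + (Δ Ω) y⟫ ≤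
      -(1 - b - a / 4) * (∫ y, Real.exp (-‖y‖ ^ 2 / 4) * χ y ^ 2 * ‖Ω y‖ ^ 2)
        + ∫ y, Real.exp (-‖y‖ ^ 2 / 4) *
            ((‖fderiv ℝ χ y‖ * ‖B y‖ + 3 * ‖fderiv ℝ χ y‖ ^ 2) * ‖Ω y‖ ^ 2) := by
  set γ : EuclideanSpace ℝ (Fin 3) → ℝ := fun y => Real.exp (-‖y‖ ^ 2 / 4) with hγdef
  have hΩ1 : ContDiff ℝ 1 Ω := hΩ.of_le one_le_two
  have hγ0 : ∀ y, 0 ≤ γ y := fun y => (Real.exp_pos _).le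
  -- pointwise decomposition of the integrand
  have hI : (fun y => γ y * χ y ^ 2 *
      ⟪Ω y, curl (fun z => cross (B z + (1 / 2 : ℝ) • z) (Ω z)) y + (Δ Ω) y⟫) = fun y =>
      (γ y * χ y ^ 2 * ⟪Ω y, fderiv ℝ B y (Ω y)⟫ - γ y * χ y ^ 2 * ‖Ω y‖ ^ 2)
        - γ y * χ y ^ 2 * ⟪convect B Ω y, Ω y⟫
        + γ y * ⟪(Δ Ω) y - (1 / 2 : ℝ) • fderiv ℝ Ω y y, χ y ^ 2 • Ω y⟫ := by
    funext y
    have hc : ⟪Ω y, (Δ Ω) y⟫ = ⟪(Δ Ω) y, Ω y⟫ := real_inner_comm _ _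
    rw [inner_add_right, inner_curl_cross_wind_eq (hB.differentiable one_ne_zero y)
      (hΩ1.differentiable one_ne_zero y) (hdivB y) (hdivΩ y), real_inner_smul_right, inner_sub_left,
      real_inner_smul_left, hc]
    ring
  -- continuity of the ingredients
  have cγ : Continuous γ := (contDiff_gaussianWeightFun (n := 0)).continuous
  have cχ : Continuous χ := hχ.continuous
  have cDχ : Continuous (fderiv ℝ χ) := hχ.continuous_fderiv one_ne_zero
  have cB : Continuous B := hB.continuous
  have cDB : Continuous (fderiv ℝ B) := hB.continuous_fderiv one_ne_zero
  have cΩ : Continuous Ω := hΩ1.continuous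
  have cDΩ : Continuous (fderiv ℝ Ω) := hΩ1.continuous_fderiv one_ne_zero
  have cΔ : Continuous (Δ Ω) := continuous_laplacian hΩ
  have hK : ∀ y ∉ tsupport χ, χ y = 0 := fun y hy => image_eq_zero_of_notMem_tsupport hy
  have hK' : ∀ y ∉ tsupport χ, fderiv ℝ χ y = 0 := fun y hy => fderiv_of_notMem_tsupport ℝ hy
  have cs : ∀ {f : EuclideanSpace ℝ (Fin 3) → ℝ}, Continuous f → (∀ y ∉ tsupport χ, f y = 0) → Integrable f :=
    fun hf h0 => hf.integrable_of_hasCompactSupport (HasCompactSupport.intro hχc h0)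
  -- integrability of every term
  have iE : Integrable (fun y => γ y * χ y ^ 2 * ‖Ω y‖ ^ 2) :=
    cs ((cγ.mul (cχ.pow 2)).mul (cΩ.norm.pow 2)) fun y hy => by simp [hK y hy]
  have i1a : Integrable (fun y => γ y * χ y ^ 2 * ⟪Ω y, fderiv ℝ B y (Ω y)⟫) :=
    cs ((cγ.mul (cχ.pow 2)).mul (cΩ.inner (cDB.clm_apply cΩ))) fun y hy => by simp [hK y hy]
  have i1 : Integrable (fun y => γ y * χ y ^ 2 * ⟪Ω y, fderiv ℝ B y (Ω y)⟫
      - γ y * χ y ^ 2 * ‖Ω y‖ ^ 2) := i1a.sub iE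
  have i2 : Integrable (fun y => γ y * χ y ^ 2 * ⟪convect B Ω y, Ω y⟫) :=
    cs ((cγ.mul (cχ.pow 2)).mul ((cDΩ.clm_apply cB).inner cΩ)) fun y hy => by simp [hK y hy]
  have i3 : Integrable (fun y => γ y * ⟪(Δ Ω) y - (1 / 2 : ℝ) • fderiv ℝ Ω y y, χ y ^ 2 • Ω y⟫) :=
    cs (cγ.mul ((cΔ.sub ((cDΩ.clm_apply continuous_id).const_smul (1 / 2 : ℝ))).inner
      ((cχ.pow 2).smul cΩ)))
      fun y hy => by simp [hK y hy]
  have iyB : Integrable (fun y => γ y * χ y ^ 2 * (⟪y, B y⟫ * ‖Ω y‖ ^ 2)) :=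
    cs ((cγ.mul (cχ.pow 2)).mul ((continuous_id.inner cB).mul (cΩ.norm.pow 2)))
      fun y hy => by simp [hK y hy]
  have iD1 : Integrable (fun y => γ y * (χ y * fderiv ℝ χ y (B y) * ‖Ω y‖ ^ 2)) :=
    cs (cγ.mul ((cχ.mul (cDχ.clm_apply cB)).mul (cΩ.norm.pow 2))) fun y hy => by simp [hK y hy]
  have iD2 : Integrable (fun y => γ y * (‖fderiv ℝ χ y‖ * ‖B y‖ * ‖Ω y‖ ^ 2)) :=
    cs (cγ.mul ((cDχ.norm.mul cB.norm).mul (cΩ.norm.pow 2))) fun y hy => by simp [hK' y hy]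
  have iD3 : Integrable (fun y => γ y * (‖fderiv ℝ χ y‖ ^ 2 * ‖Ω y‖ ^ 2)) :=
    cs (cγ.mul ((cDχ.norm.pow 2).mul (cΩ.norm.pow 2))) fun y hy => by simp [hK' y hy]
  -- (1) stretching and dilution: `⟪Ω, DB Ω⟫ − |Ω|² ≤ (b − 1)|Ω|²`
  have hT1 : ∫ y, (γ y * χ y ^ 2 * ⟪Ω y, fderiv ℝ B y (Ω y)⟫ - γ y * χ y ^ 2 * ‖Ω y‖ ^ 2) ≤
      (b - 1) * ∫ y, γ y * χ y ^ 2 * ‖Ω y‖ ^ 2 := by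
    rw [← integral_const_mul]
    refine integral_mono i1 (iE.const_mul _) fun y => ?_
    have h1 : ⟪Ω y, fderiv ℝ B y (Ω y)⟫ ≤ b * ‖Ω y‖ ^ 2 :=
      calc ⟪Ω y, fderiv ℝ B y (Ω y)⟫ ≤ ‖Ω y‖ * ‖fderiv ℝ B y (Ω y)‖ := real_inner_le_norm _ _
        _ ≤ ‖Ω y‖ * (b * ‖Ω y‖) := by
            refine mul_le_mul_of_nonneg_left ?_ (norm_nonneg _)
            exact ((fderiv ℝ B y).le_opNorm _).trans (mul_le_mul_of_nonneg_right (hb y) (norm_nonneg _))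
        _ = b * ‖Ω y‖ ^ 2 := by ring
    have h2 : 0 ≤ γ y * χ y ^ 2 := mul_nonneg (hγ0 y) (sq_nonneg _)
    have h3 := mul_le_mul_of_nonneg_left h1 h2
    show γ y * χ y ^ 2 * ⟪Ω y, fderiv ℝ B y (Ω y)⟫ - γ y * χ y ^ 2 * ‖Ω y‖ ^ 2 ≤
      (b - 1) * (γ y * χ y ^ 2 * ‖Ω y‖ ^ 2)
    have e : γ y * χ y ^ 2 * (b * ‖Ω y‖ ^ 2) = b * (γ y * χ y ^ 2 * ‖Ω y‖ ^ 2) := by ring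
    rw [e] at h3
    linarith
  -- (2) the drift: integrate by parts, `¼ (y·B) ≤ a/4` and the cut-off error `χ Dχ[B] ≤ ‖Dχ‖ |B|`
  have hT2 : -(∫ y, γ y * χ y ^ 2 * ⟪convect B Ω y, Ω y⟫) ≤
      a / 4 * (∫ y, γ y * χ y ^ 2 * ‖Ω y‖ ^ 2)
        + ∫ y, γ y * (‖fderiv ℝ χ y‖ * ‖B y‖ * ‖Ω y‖ ^ 2) := by
    have hibp := integral_gaussian_cutoff_sq_inner_convect hB hdivB hΩ1 hχ hχc
    rw [hibp]
    have hA : -(a * ∫ y, γ y * χ y ^ 2 * ‖Ω y‖ ^ 2) ≤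
        ∫ y, γ y * χ y ^ 2 * (⟪y, B y⟫ * ‖Ω y‖ ^ 2) := by
      rw [← integral_const_mul, ← integral_neg]
      refine integral_mono (iE.const_mul _).neg iyB fun y => ?_
      have h1 : -a ≤ ⟪y, B y⟫ := by
        have := abs_real_inner_le_norm y (B y)
        have := neg_abs_le ⟪y, B y⟫
        linarith [ha y]
      have h2 : 0 ≤ γ y * χ y ^ 2 * ‖Ω y‖ ^ 2 := mul_nonneg (mul_nonneg (hγ0 y) (sq_nonneg _)) (sq_nonneg _)
      have h3 := mul_le_mul_of_nonneg_right h1 h2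
      show -(a * (γ y * χ y ^ 2 * ‖Ω y‖ ^ 2)) ≤ γ y * χ y ^ 2 * (⟪y, B y⟫ * ‖Ω y‖ ^ 2)
      have e : γ y * χ y ^ 2 * (⟪y, B y⟫ * ‖Ω y‖ ^ 2) = ⟪y, B y⟫ * (γ y * χ y ^ 2 * ‖Ω y‖ ^ 2) := by
        ring
      rw [e]
      linarith
    have hBd : ∫ y, γ y * (χ y * fderiv ℝ χ y (B y) * ‖Ω y‖ ^ 2) ≤
        ∫ y, γ y * (‖fderiv ℝ χ y‖ * ‖B y‖ * ‖Ω y‖ ^ 2) := by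
      refine integral_mono iD1 iD2 fun y => ?_
      refine mul_le_mul_of_nonneg_left (mul_le_mul_of_nonneg_right ?_ (sq_nonneg _)) (hγ0 y)
      calc χ y * fderiv ℝ χ y (B y) ≤ |χ y * fderiv ℝ χ y (B y)| := le_abs_self _
        _ = |χ y| * |fderiv ℝ χ y (B y)| := abs_mul _ _
        _ ≤ 1 * (‖fderiv ℝ χ y‖ * ‖B y‖) := by
            refine mul_le_mul (hχ1 y) ?_ (abs_nonneg _) zero_le_one
            rw [← Real.norm_eq_abs]
            exact (fderiv ℝ χ y).le_opNorm _
        _ = ‖fderiv ℝ χ y‖ * ‖B y‖ := one_mul _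
    linarith
  -- (3) dissipation, Leray transport and the cut-off gradient
  have hT3 := integral_gaussian_inner_laplacian_leray_cutoff_sq_le hΩ hχ hχc
  -- assemble
  have hsplit : ∫ y, γ y * ((‖fderiv ℝ χ y‖ * ‖B y‖ + 3 * ‖fderiv ℝ χ y‖ ^ 2) * ‖Ω y‖ ^ 2) =
      (∫ y, γ y * (‖fderiv ℝ χ y‖ * ‖B y‖ * ‖Ω y‖ ^ 2))
        + 3 * ∫ y, γ y * (‖fderiv ℝ χ y‖ ^ 2 * ‖Ω y‖ ^ 2) := by
    rw [← integral_const_mul, ← integral_add iD2 (iD3.const_mul _)]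
    refine integral_congr_ae (Eventually.of_forall fun y => ?_)
    simp only
    ring
  have i12 : Integrable (fun y => γ y * χ y ^ 2 * ⟪Ω y, fderiv ℝ B y (Ω y)⟫
      - γ y * χ y ^ 2 * ‖Ω y‖ ^ 2 - γ y * χ y ^ 2 * ⟪convect B Ω y, Ω y⟫) := i1.sub i2
  rw [hI, integral_add i12 i3, integral_sub i1 i2, hsplit]
  linarith

end Summit.NavierStokesRegularity.NavierStokesRegularity.Theorems

end
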